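import Summits.BirchSwinnertonDyer.BirchSwinnertonDyer.Theorems.ErratumRoadFiveNonSurjCornerFiveImageExact
import Literature.NumberTheory.EllipticCurves.SupersingularDensitySerreTraceProofs
import Literature.NumberTheory.EllipticCurves.ModPIrreducibleCongruenceTransferProofs
import Mathlib.LinearAlgebra.Trace
import Mathlib.LinearAlgebra.Determinant
import HarnessLib

/-!
# Route `ErratumRoadFive` (K2), crux `NonSurjCorner` (item stmt-BirchSwinnertonDyer-19065) ∕ child `NonSurjCornerTwinMuAn` (19948):
# NO FROBENIUS OF PROJECTIVE ORDER SIX ON THE CORNER AT `5` — the trace test `a_ℓ(E)² ≢ 3ℓ (mod 5)` at every good prime `ℓ ≠ 5`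
# (cell `bsd-stepL`, WIDTH-LEVER lane B `bsd-stepL-corner5-p2` g10; `--supports stmt-BirchSwinnertonDyer-19948 --as helper`)

WHY. Lane B counts 19948's `μ_an = 0` certificates per mod-`5` CONGRUENCE CLASS (ρ̄-door, p621412) and, since the Serre-level door (p628991),
enumerates the candidate classes level by level among ALL weight-2 newform classes `(g, ℘ ∣ 5)` of a given level. The sieve that discards
a newform class as «not a corner class» is Sutherland's trace test: an element `γ ∈ GL₂(𝔽₅)` with `tr(γ)² = 3·det(γ)` has eigenvalue
ratio a primitive 6th root of unity, i.e. projective order `6`, and NEITHER possible image of a corner pair at `5` — the normaliser of a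
split Cartan subgroup (`5Ns`, projectively `D₄`) or a conjugate of Zywina's `G₉` (`5S4`, projectively `𝔖₄`) — contains such an element.
This file makes the sieve a KERNEL THEOREM about every pair `(E, 5)` with `E` multiplicative at `5`, `E[5]` irreducible and `ρ̄_{E,5}`
not onto (no `ClassX11a/b`, rank or (ram) hypothesis is needed): at every good prime `ℓ ≠ 5`, `a_ℓ(E)² − 3ℓ ≢ 0 (mod 5)`.

* §1 `Quad.traceSq_ne_three_mul_det_of_inG9` — the finite computation (`decide` over the `625` quadruples): an invertible quadruple
  passing Zywina's membership test `inG9` has `(a + d)² ≠ 3(ad − bc)`.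
* §2 `traceSq_ne_three_mul_det_of_mem_image_five` — in any frame `(e, Φ)`: every element `x` of the image `Φ(ρ̄_{E,5}(Γ_ℚ))` has
  `tr(x)² ≠ 3 det(x)` (the image has order prime to `5` and contains the inertia half-Cartan `P (1 0; 0 *) P⁻¹`; in the frame `P` every
  element passes `inG9` or produces an element of order `5` — the lane's `le_G9_of_halfDiagonalSubgroup_le` argument (g2∕g5) verbatim).
* §3 `NonSurjCorner.frobeniusTrace_sq_sub_three_mul_ne_zero_five` — the trace test at the good primes (`tr ρ̄(Frob_ℓ) = a_ℓ`, `det = ℓ`), and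
  the instances over the route binders `NonSurjTwin.traceTest_five` (19948's population, `ClassX11a`) ∕ `NonSurjCorner.traceTest_five` (19065's, `ClassX11b`).

HONEST FRAMING: structure theorems about Galois images (no named fact is used beyond those already inside the imported image files; none is
added); nothing here proves the crux, a registered stub, or BSD for any class; no census number moves (T7). The converse direction of the
census sieve («no order-6 Frobenius among the first 100 primes ⟹ exotic image») remains Chebotarev-heuristic evidence, not a theorem.
[cite: Serre1972, §2.2, §2.6] [cite: Zywina2015, §1.3 (G₉), Thm. 1.4] [cite: Sutherland2016, §5.2 (trace–determinant invariants of Frobenius)]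
-/

set_option linter.dupNamespace false -- `Summit.BirchSwinnertonDyer.BirchSwinnertonDyer` (summit = problem), tree-wide

noncomputable section

open scoped Classical NumberField

namespace Summit.BirchSwinnertonDyer.BirchSwinnertonDyer.Theorems.ZywinaG9

open Matrix Literature.NumberTheory.GaloisRepresentations
  Literature.NumberTheory.GaloisRepresentations.Serre1972
  Literature.NumberTheory.EllipticCurves Literature.NumberTheory.EllipticCurves.Zywina2015G9
  Literature.NumberTheory.EllipticCurves.Zywina2015G9.Quad

/-! ### §1. The finite computation -/

/-- **No eigenvalue ratio of order `6` inside `G₉`.** For every invertible quadruple `(a b; c d)` over `𝔽₅` passing Zywina's explicit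
membership test `inG9`: `(a + d)² ≠ 3 (ad − bc)` (an element with `tr² = 3 det` has projective order `6`; `G₉ ↠ 𝔖₄` has none).
Checked by `decide` over the `625` quadruples. [folklore] -/
theorem Quad.traceSq_ne_three_mul_det_of_inG9 : ∀ a b c d : ZMod 5,
    det (a, b, c, d) ≠ 0 → inG9 (a, b, c, d) = true → (a + d) ^ 2 ≠ 3 * det (a, b, c, d) := by
  decide +kernel

/-- `Quad.traceSq_ne_three_mul_det_of_inG9` for a quadruple variable. [folklore] -/
theorem Quad.traceSq_ne_three_mul_det_of_inG9' (x : Quad) (hdet : det x ≠ 0) (hx : inG9 x = true) :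
    (x.1 + x.2.2.2) ^ 2 ≠ 3 * det x := by
  obtain ⟨a, b, c, d⟩ := x
  exact Quad.traceSq_ne_three_mul_det_of_inG9 a b c d hdet hx

variable [Fact (Nat.Prime 5)]

/-- The trace of a `2 × 2` matrix over `𝔽₅` in the quadruple model. [folklore] -/
theorem trace_eq_ofMatrix_add (A : Matrix (Fin 2) (Fin 2) (ZMod 5)) :
    A.trace = (Quad.ofMatrix A).1 + (Quad.ofMatrix A).2.2.2 := by
  rw [Matrix.trace_fin_two]; rfl

/-- **A `5'`-subgroup of `GL₂(𝔽₅)` containing the diagonal torus `{diag(1, u)}` has no element with `tr² = 3 det`**: an element failing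
`inG9` yields an element of order `5` (`Quad.cert_of_not_inG9`, the g2 argument of `le_G9_of_halfDiagonalSubgroup_le`), and an element
passing it is covered by §1. [cite: Zywina2015, §1.3] [cite: Serre1972, §2.6] -/
theorem traceSq_ne_three_mul_det_of_halfDiagonalSubgroup_le {H : Subgroup (GL (Fin 2) (ZMod 5))}
    (h5 : ¬ 5 ∣ Nat.card H) (hT : halfDiagonalSubgroup (ZMod 5) ≤ H) {x : GL (Fin 2) (ZMod 5)} (hx : x ∈ H) :
    (Matrix.trace (x : Matrix (Fin 2) (Fin 2) (ZMod 5))) ^ 2 ≠ 3 * Matrix.det (x : Matrix (Fin 2) (Fin 2) (ZMod 5)) := by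
  obtain ⟨-, h, -, -, -, -, hhq, -, -⟩ := exists_generators
  have hh : h ∈ H := hT (mem_halfDiagonalSubgroup_of_ofMatrix_eq hhq)
  cases hin : Quad.inG9 (Quad.ofMatrix (x : Matrix (Fin 2) (Fin 2) (ZMod 5)))
  swap
  · rw [trace_eq_ofMatrix_add, ← Quad.det_ofMatrix]
    exact Quad.traceSq_ne_three_mul_det_of_inG9' _ (det_ofMatrix_ne_zero x) hin
  exfalso
  obtain ⟨i, hcert⟩ := Quad.cert_of_not_inG9' _ (det_ofMatrix_ne_zero x) hin
  obtain ⟨h4, h20⟩ := (Quad.cert_iff _).mp hcert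
  obtain ⟨w, hwmem, hofw⟩ := exists_wordGL H hx hh hhq i
  have hv1 : w ^ 4 ≠ 1 := by
    intro h1
    apply h4
    rw [← hofw, ← Quad.ofMatrix_coe_pow, h1, Units.val_one]
    exact Quad.ofMatrix_one
  have hv5 : (w ^ 4) ^ 5 = 1 := by
    apply eq_of_ofMatrix_eq
    rw [← pow_mul, Quad.ofMatrix_coe_pow, hofw, Units.val_one, Quad.ofMatrix_one]
    exact h20
  have hord : orderOf (⟨w ^ 4, H.pow_mem hwmem 4⟩ : H) = 5 := by
    rw [Subgroup.orderOf_mk]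
    exact orderOf_eq_prime hv5 hv1
  have hdvd := orderOf_dvd_natCard (⟨w ^ 4, H.pow_mem hwmem 4⟩ : H)
  rw [hord] at hdvd
  exact h5 hdvd

/-- **Conjugate frame.** A `5'`-subgroup of `GL₂(𝔽₅)` containing a split half-Cartan subgroup `P (1 0; 0 *) P⁻¹` has no element with
`tr² = 3 det` (conjugate by `P⁻¹` to the diagonal frame; trace and determinant are class functions). [cite: Serre1972, §2.1 a), §2.6] -/
theorem traceSq_ne_three_mul_det_of_halfSplitCartan_le {H : Subgroup (GL (Fin 2) (ZMod 5))}
    (h5 : ¬ 5 ∣ Nat.card H) {P : GL (Fin 2) (ZMod 5)} (hT : halfSplitCartan P ≤ H)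
    {x : GL (Fin 2) (ZMod 5)} (hx : x ∈ H) :
    (Matrix.trace (x : Matrix (Fin 2) (Fin 2) (ZMod 5))) ^ 2 ≠ 3 * Matrix.det (x : Matrix (Fin 2) (Fin 2) (ZMod 5)) := by
  let f : GL (Fin 2) (ZMod 5) →* GL (Fin 2) (ZMod 5) := (MulAut.conj P⁻¹).toMonoidHom
  have hf : Function.Injective f := fun a b hab => (MulAut.conj P⁻¹).injective hab
  let H' : Subgroup (GL (Fin 2) (ZMod 5)) := H.map f
  have hcard : Nat.card H' = Nat.card H := Subgroup.card_map_of_injective hf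
  have hT' : halfDiagonalSubgroup (ZMod 5) ≤ H' := by
    intro d hd
    have hPd : (MulAut.conj P).toMonoidHom d ∈ H := hT ⟨d, hd, rfl⟩
    refine ⟨(MulAut.conj P).toMonoidHom d, hPd, ?_⟩
    change P⁻¹ * (P * d * P⁻¹) * P⁻¹⁻¹ = d
    group
  have h5' : ¬ 5 ∣ Nat.card H' := by rw [hcard]; exact h5
  have hx' : f x ∈ H' := ⟨x, hx, rfl⟩
  have key := traceSq_ne_three_mul_det_of_halfDiagonalSubgroup_le h5' hT' hx'
  -- `f x = P⁻¹ x P`: same trace and determinant as `x`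
  have hfx : ((f x : GL (Fin 2) (ZMod 5)) : Matrix (Fin 2) (Fin 2) (ZMod 5)) =
      (P⁻¹ : GL (Fin 2) (ZMod 5)) * (x : Matrix (Fin 2) (Fin 2) (ZMod 5)) * (P : GL (Fin 2) (ZMod 5)) := by
    change (((P⁻¹ * x * P⁻¹⁻¹ : GL (Fin 2) (ZMod 5))) : Matrix (Fin 2) (Fin 2) (ZMod 5)) = _
    rw [inv_inv, Units.val_mul, Units.val_mul]
  have htr : Matrix.trace ((f x : GL (Fin 2) (ZMod 5)) : Matrix (Fin 2) (Fin 2) (ZMod 5)) =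
      Matrix.trace (x : Matrix (Fin 2) (Fin 2) (ZMod 5)) := by
    rw [hfx, Matrix.mul_assoc, Matrix.trace_mul_comm, Matrix.mul_assoc, ← Units.val_mul, mul_inv_cancel,
      Units.val_one, Matrix.mul_one]
  have hdet : Matrix.det ((f x : GL (Fin 2) (ZMod 5)) : Matrix (Fin 2) (Fin 2) (ZMod 5)) =
      Matrix.det (x : Matrix (Fin 2) (Fin 2) (ZMod 5)) := by
    rw [hfx, Matrix.det_mul, Matrix.det_mul, mul_right_comm, ← Matrix.det_mul, ← Units.val_mul, inv_mul_cancel,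
      Units.val_one, Matrix.det_one, one_mul]
  rwa [htr, hdet] at key

end Summit.BirchSwinnertonDyer.BirchSwinnertonDyer.Theorems.ZywinaG9

namespace Summit.BirchSwinnertonDyer.BirchSwinnertonDyer.Theorems.CornerShape

open WeierstrassCurve NumberField IsDedekindDomain Field Matrix
  Literature.NumberTheory.EllipticCurves Literature.NumberTheory.GaloisRepresentations
  Literature.NumberTheory.GaloisRepresentations.Serre1972
  Literature.NumberTheory.EllipticCurves.Rank1Residual
  Rat.HeightOneSpectrum
  Summit.BirchSwinnertonDyer.Rank1Residual
  Summit.BirchSwinnertonDyer.BirchSwinnertonDyer.Theorems.ZywinaG9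

/-! ### §2. Every element of the image of a corner pair at `5` -/

/-- **No element with `tr² = 3 det` in the mod-`5` image** of a curve multiplicative at `5` with `E[5]` irreducible and `ρ̄_{E,5}` not onto,
in any frame `(e, Φ)`: the image has order prime to `5` (`Irr ∧ ¬Surj`, Serre Prop. 15) and contains the inertia half-Cartan
`P (1 0; 0 *) P⁻¹` at a prime above `5` (Tate curve, §1.12). [cite: Serre1972, §1.12, §2.4 Prop. 15, §2.6] -/
theorem traceSq_ne_three_mul_det_of_mem_image_five (W : WeierstrassCurve ℚ) [W.IsElliptic] [Fact (Nat.Prime 5)]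
    (Φ : Multiplicative (AddAut (geomTorsion W 5)) ≃* GL (Fin 2) (ZMod 5))
    (e : geomTorsion W 5 ≃+ (Fin 2 → ZMod 5))
    (he : ∀ (g : Multiplicative (AddAut (geomTorsion W 5))) (x : geomTorsion W 5),
      e (Multiplicative.toAdd g x) = ((Φ g : GL (Fin 2) (ZMod 5)) : Matrix (Fin 2) (Fin 2) (ZMod 5)) *ᵥ e x)
    (hmult : Mult W 5) (hirr : Irr W 5) (hns : ¬ Surj W 5)
    {x : GL (Fin 2) (ZMod 5)} (hx : x ∈ (galoisRepTorsion W 5).range.map Φ.toMonoidHom) :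
    (Matrix.trace (x : Matrix (Fin 2) (Fin 2) (ZMod 5))) ^ 2 ≠ 3 * Matrix.det (x : Matrix (Fin 2) (Fin 2) (ZMod 5)) := by
  have hpG : ¬ 5 ∣ Nat.card ((galoisRepTorsion W 5).range.map Φ.toMonoidHom) :=
    not_dvd_card_of_not_hasSurjectiveModNGaloisRep W 5 Φ e he hirr hns
  have hpp : Nat.Prime 5 := Fact.out
  set v : HeightOneSpectrum (𝓞 ℚ) := (primesEquiv (R := 𝓞 ℚ)).symm ⟨5, hpp⟩ with hvdef
  have hv' : primesEquiv v = ⟨5, hpp⟩ := Equiv.apply_symm_apply _ _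
  have hv : (primesEquiv v : ℕ) = 5 := congrArg Subtype.val hv'
  obtain ⟨𝔏, h𝔏⟩ := HeightOneSpectrum.primesAbove_nonempty v
  obtain ⟨P, hP⟩ :=
    GaloisImage.exists_halfSplitCartan_eq_inertia_image_of_mult W 5 Φ e he (by decide) hmult hpG hv h𝔏
  have hCG : halfSplitCartan P ≤ (galoisRepTorsion W 5).range.map Φ.toMonoidHom := by
    rw [← hP]
    exact Subgroup.map_mono (fun x ⟨τ, _, hτ⟩ ↦ ⟨τ, hτ⟩)
  exact traceSq_ne_three_mul_det_of_halfSplitCartan_le hpG hCG hx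

/-! ### §3. The trace test at the good primes -/

/-- **THE TRACE TEST ON THE CORNER AT `5`.** `E/ℚ` globally minimal, multiplicative at `5`, `E[5]` irreducible, `ρ̄_{E,5}` NOT onto ⟹ at every
prime `ℓ ≠ 5` of good reduction: `a_ℓ(E)² − 3ℓ ≢ 0 (mod 5)` — the Frobenius at `ℓ` (trace `a_ℓ`, determinant `ℓ` on `E[5]`) is never of
projective order `6`. This is the necessary condition by which lane B's Serre-level census discards a weight-2 newform class `(g, ℘)` as
«not a corner class» as soon as ONE coefficient has `a_ℓ(g)² ≡ 3ℓ (mod ℘)`. [cite: Serre1972, §2.2, §2.6] [cite: Zywina2015, Thm. 1.4] -/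
theorem NonSurjCorner.frobeniusTrace_sq_sub_three_mul_ne_zero_five (W : WeierstrassCurve ℚ) [W.IsElliptic]
    [W.IsGloballyMinimal] [Fact (Nat.Prime 5)] (hmult : Mult W 5) (hirr : Irr W 5) (hns : ¬ Surj W 5)
    (ℓ : ℕ) [hℓ : Fact ℓ.Prime] (hℓ5 : ℓ ≠ 5) (hgood : W.HasGoodReductionAtPrime ℓ) :
    ((W.frobeniusTrace ℓ ^ 2 - 3 * ℓ : ℤ) : ZMod 5) ≠ 0 := by
  letI : Module (ZMod 5) (W.geomTorsion (5 : ℕ)) := AddSubgroup.torsionBy.zmodModule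
  obtain ⟨e, Φ, he, htr, -⟩ := exists_frame_galoisRepTorsion_rat W 5
  -- an arithmetic Frobenius `σ` at a prime above `ℓ`
  obtain ⟨w, hw⟩ : ∃ w : HeightOneSpectrum (𝓞 ℚ), (primesEquiv w : ℕ) = ℓ :=
    ⟨primesEquiv.symm ⟨ℓ, hℓ.out⟩, by rw [Equiv.apply_symm_apply]⟩
  obtain ⟨𝔓, h𝔓⟩ := HeightOneSpectrum.primesAbove_nonempty w
  obtain ⟨σ, hσ⟩ := HeightOneSpectrum.exists_isArithFrobAt_of_mem_primesAbove_holds h𝔓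
  set x : GL (Fin 2) (ZMod 5) := Φ (galoisRepTorsion W (5 : ℕ) σ) with hxdef
  have hx : x ∈ (galoisRepTorsion W (5 : ℕ)).range.map Φ.toMonoidHom :=
    ⟨galoisRepTorsion W (5 : ℕ) σ, ⟨σ, rfl⟩, rfl⟩
  have key := traceSq_ne_three_mul_det_of_mem_image_five W Φ e he hmult hirr hns hx
  -- trace = a_ℓ, det = ℓ (mod 5)
  have htrace : Matrix.trace (x : Matrix (Fin 2) (Fin 2) (ZMod 5)) = (W.frobeniusTrace ℓ : ZMod 5) := by
    rw [hxdef, htr]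
    exact W.trace_galoisRepTorsion_frobenius_eq 5 hℓ5 hgood hw h𝔓 hσ
  have hσM : ∀ Q : W.geomTorsion (5 : ℕ), e (σ • Q) = (x : Matrix (Fin 2) (Fin 2) (ZMod 5)) *ᵥ e Q := fun Q ↦ by
    rw [← galoisRepTorsion_apply]; exact he _ Q
  have hdet : Matrix.det (x : Matrix (Fin 2) (Fin 2) (ZMod 5)) = (ℓ : ZMod 5) := by
    rw [← W.det_galoisRepTorsion_frobenius_eq 5 hℓ5 hgood hw h𝔓 hσ]
    let eL : W.geomTorsion (5 : ℕ) ≃ₗ[ZMod 5] (Fin 2 → ZMod 5) :=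
      LinearEquiv.ofBijective (e.toAddMonoidHom.toZModLinearMap 5) ⟨e.injective, e.surjective⟩
    have heL : ∀ Q : W.geomTorsion (5 : ℕ), eL Q = e Q := fun _ ↦ rfl
    have hconj : Matrix.toLin' (x : Matrix (Fin 2) (Fin 2) (ZMod 5)) =
        eL.conj ((galoisRepTorsion W (5 : ℕ) σ).toAdd.toAddMonoidHom.toZModLinearMap 5) := by
      refine LinearMap.ext fun u ↦ ?_
      obtain ⟨Q, rfl⟩ := eL.surjective u
      rw [LinearEquiv.conj_apply_apply, eL.symm_apply_apply, heL, heL, Matrix.toLin'_apply]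
      change (x : Matrix (Fin 2) (Fin 2) (ZMod 5)) *ᵥ (e Q) = e (σ • Q)
      rw [hσM]
    rw [← LinearMap.det_toLin' (x : Matrix (Fin 2) (Fin 2) (ZMod 5)), hconj, LinearEquiv.conj_apply,
      LinearMap.comp_assoc, LinearMap.det_conj]
  rw [htrace, hdet] at key
  intro h0
  apply key
  have : ((W.frobeniusTrace ℓ ^ 2 - 3 * ℓ : ℤ) : ZMod 5) = (W.frobeniusTrace ℓ : ZMod 5) ^ 2 - 3 * (ℓ : ZMod 5) := by
    push_cast; ring
  rw [this] at h0
  exact sub_eq_zero.mp h0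

/-- **The trace test on 19948's population** (`ClassX11a` at `5`, `ρ̄` not onto; the self-carrier hypothesis is not needed): at every good
prime `ℓ ≠ 5`, `a_ℓ² − 3ℓ ≢ 0 (mod 5)`. [cite: Serre1972, §2.6] [cite: Zywina2015, Thm. 1.4] -/
theorem NonSurjTwin.traceTest_five (Wd : WeierstrassCurve ℚ) [Wd.IsElliptic] [Wd.IsGloballyMinimal] [Fact (Nat.Prime 5)]
    (hX : ClassX11a Wd 5) (hns : ¬ Surj Wd 5) (ℓ : ℕ) [Fact ℓ.Prime] (hℓ5 : ℓ ≠ 5) (hgood : Wd.HasGoodReductionAtPrime ℓ) :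
    ((Wd.frobeniusTrace ℓ ^ 2 - 3 * ℓ : ℤ) : ZMod 5) ≠ 0 :=
  NonSurjCorner.frobeniusTrace_sq_sub_three_mul_ne_zero_five Wd hX.2.2.1 hX.2.2.2.1 hns ℓ hℓ5 hgood

/-- **The trace test on 19065's population** (`ClassX11b` at `5`, `ρ̄` not onto): at every good prime `ℓ ≠ 5`, `a_ℓ² − 3ℓ ≢ 0 (mod 5)`.
[cite: Serre1972, §2.6] [cite: Zywina2015, Thm. 1.4] -/
theorem NonSurjCorner.traceTest_five (W : WeierstrassCurve ℚ) [W.IsElliptic] [W.IsGloballyMinimal] [Fact (Nat.Prime 5)]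
    (hX : ClassX11b W 5) (hns : ¬ Surj W 5) (ℓ : ℕ) [Fact ℓ.Prime] (hℓ5 : ℓ ≠ 5) (hgood : W.HasGoodReductionAtPrime ℓ) :
    ((W.frobeniusTrace ℓ ^ 2 - 3 * ℓ : ℤ) : ZMod 5) ≠ 0 :=
  NonSurjCorner.frobeniusTrace_sq_sub_three_mul_ne_zero_five W hX.2.2.1 hX.2.2.2 hns ℓ hℓ5 hgood

end Summit.BirchSwinnertonDyer.BirchSwinnertonDyer.Theorems.CornerShape

end
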